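import Summits.KontsevichZagierPeriods.Statement
import Literature.NumberTheory.Transcendental.KZCalculusProofs
import Literature.NumberTheory.Transcendental.KZVolumeConjectureProofs
import Literature.NumberTheory.Transcendental.KZKernelConjectureForms
import Literature.NumberTheory.Transcendental.KZUnfolding

/-!
# `VolumeFormOffPlane` (stmt-KontsevichZagierPeriods-14935) — negative side, core (route-file-free)

Refuter (`cdisprove`, cycle 1) by-products for the crux `VolumeFormOffPlane` of route
`SymplecticScissors` — the frame `VolumeForm` (stmt-3814) restricted to dimensions `N ≠ 2`:

  `∀ ⦃N⦄, N ≠ 2 → ∀ r r' : KZ.IntegralRep N, (integrand r = 1 on its domain) →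
     (integrand r' = 1 on its domain) → r.value = r'.value → KZ.Equivalent r r'`.

This file deliberately does NOT import the route file and declares NO definition: every statement
is spelled out over the SLICE at one dimension `N` (verbatim the body of the crux at `N`), so the
crux is the conjunction of the slices `N ≠ 2` by `Iff.rfl`, the frame `VolumeForm` is the
conjunction of all slices, and the planar layer `PlanarAreas` is the slice `N = 2`; the one-line
transcriptions to the route decls belong in a companion `Negative/Link.lean`. Nothing here refutes
the crux. Contents (all kernel-checked):

* §1 SLAB LADDER `slice_of_slice_succ` (slice `N+1` ⇒ slice `N`: unit slabs, one Newton–Leibniz move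
  each, tree lemma `KZ.IntegralRep.equivalent_slab`); hence `offPlane_iff_forall_ge_three`,
  `offPlane_iff_frame` (the hypothesis `N ≠ 2` is DECORATIVE: the crux carries the plane and the
  line), `frame_iff_kzPeriodConjecture'`, `offPlane_iff_summit` (the crux IS the summit, through the
  tree's discharge of Viu-Sos' semi-canonical reduction), failing dimensions form an up-set, and a
  same-dimension counterexample in ANY `N` kills the crux (`not_offPlane_of_counterexample`).
* §2 LOAD-BEARING: `value_eq` IS (`not_slice_zero_without_valueEq`, `not_slice_three_without_valueEq`:
  the point / a compact solid vs the empty set, by soundness); `integrand = 1` is NOT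
  (`withoutIntegrandOne_iff_kzPeriodConjecture'`: dropping it is Conjecture 1 again); `N ≠ 2` is NOT (§1).
* §3 JUNK IMMUNITY / DEGENERATE INSTANCES HOLD: value `0` forces a null domain, hence a relation
  (tree: `KZ.of_mem_levelRel_of_volume_eq_zero`); equal domains are one relation apart (tree:
  `KZ.of_sub_of_mem_relations_of_eqOn`); the slice `N = 0` is a theorem (`slice_zero`).
* §4 DEHN FORM: the frame off the plane fails iff some additive invariant `KZ.FormalRep →+ A`
  vanishing on the four move sets separates two equal-volume integrand-`1` representations of a
  dimension `N ≥ 3` — the only shape a refutation can take.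
(The refuted one-move strengthening is the companion `Negative/OneMove.lean`.)
[Kontsevich–Zagier 2001, §1.2; Viu-Sos 2021, Thm 1.1; Cresson–Viu-Sos 2022, §1 p. 326, Problem 2.1]
-/

noncomputable section

open MeasureTheory Set
open Literature.NumberTheory.Transcendental Literature.ModelTheory.ExponentialFields

namespace Summit.KontsevichZagierPeriods.SymplecticScissors.VolumeFormOffPlaneNegative

/-! ## §1 The slab ladder: `N ≠ 2` is decorative; the crux is the frame is the summit -/

/-- SLABS KEEP INTEGRAND `1`: an integrand-`1` representation of dimension `N` is KZ-equivalent to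
an integrand-`1` representation of dimension `N + d`, for every `d` (iterate the unit slab
`A ↦ A × [0,1]`, ONE Newton–Leibniz move each, `KZ.IntegralRep.equivalent_slab`).
[Kontsevich–Zagier 2001, §1.2 rule (3)] [folklore] -/
theorem exists_equivalent_add_integrand_one {N : ℕ} (r : KZ.IntegralRep N)
    (hr : ∀ x ∈ r.domain, r.integrand x = 1) :
    ∀ d : ℕ, ∃ R : KZ.IntegralRep (N + d), (∀ x ∈ R.domain, R.integrand x = 1) ∧ KZ.Equivalent r R
  | 0 => ⟨r, hr, KZ.Equivalent.refl r⟩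
  | d + 1 => by
    obtain ⟨R, hR1, hR⟩ := exists_equivalent_add_integrand_one r hr d
    exact ⟨R.slab 0, R.slab_integrand_eq_one 0 hR1, hR.trans (R.equivalent_slab 0)⟩

/-- **SLAB LADDER.** The frame descends along dimensions: the slice at `N + 1` implies the slice at
`N` (raise both representations by one unit slab; the slabs have integrand `1` and, by soundness of
the moves, equal values). [folklore] -/
theorem slice_of_slice_succ {N : ℕ}
    (h : ∀ (r r' : KZ.IntegralRep (N + 1)), (∀ x ∈ r.domain, r.integrand x = 1) →
      (∀ x ∈ r'.domain, r'.integrand x = 1) → r.value = r'.value → KZ.Equivalent r r')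
    (r r' : KZ.IntegralRep N) (hr : ∀ x ∈ r.domain, r.integrand x = 1)
    (hr' : ∀ x ∈ r'.domain, r'.integrand x = 1) (hv : r.value = r'.value) : KZ.Equivalent r r' := by
  have e1 : r.value = (r.slab 0).value := KZ.Equivalent.value_eq_holds (r.equivalent_slab 0)
  have e2 : r'.value = (r'.slab 0).value := KZ.Equivalent.value_eq_holds (r'.equivalent_slab 0)
  have h1 := h (r.slab 0) (r'.slab 0) (r.slab_integrand_eq_one 0 hr)
    (r'.slab_integrand_eq_one 0 hr') (by rw [← e1, ← e2]; exact hv)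
  exact ((r.equivalent_slab 0).trans h1).trans (r'.equivalent_slab 0).symm

/-- The ladder iterated: the slice at `N` implies the slice at every `M ≤ N`. [folklore] -/
theorem slice_of_slice_of_le {M N : ℕ} (hMN : M ≤ N)
    (h : ∀ (r r' : KZ.IntegralRep N), (∀ x ∈ r.domain, r.integrand x = 1) →
      (∀ x ∈ r'.domain, r'.integrand x = 1) → r.value = r'.value → KZ.Equivalent r r') :
    ∀ (r r' : KZ.IntegralRep M), (∀ x ∈ r.domain, r.integrand x = 1) →
      (∀ x ∈ r'.domain, r'.integrand x = 1) → r.value = r'.value → KZ.Equivalent r r' := by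
  obtain ⟨d, rfl⟩ := Nat.exists_eq_add_of_le hMN
  clear hMN
  induction d with
  | zero => simpa using h
  | succ d ih => exact ih (fun s s' hs hs' hsv => slice_of_slice_succ h s s' hs hs' hsv)

/-- **`N ≠ 2` IS DECORATIVE, I**: the frame off the plane is the frame from dimension `3` on
(the slices `0, 1` descend from the slice `3`). [folklore] -/
theorem offPlane_iff_forall_ge_three :
    (∀ N, N ≠ 2 → ∀ (r r' : KZ.IntegralRep N), (∀ x ∈ r.domain, r.integrand x = 1) →
      (∀ x ∈ r'.domain, r'.integrand x = 1) → r.value = r'.value → KZ.Equivalent r r') ↔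
    (∀ N, 3 ≤ N → ∀ (r r' : KZ.IntegralRep N), (∀ x ∈ r.domain, r.integrand x = 1) →
      (∀ x ∈ r'.domain, r'.integrand x = 1) → r.value = r'.value → KZ.Equivalent r r') := by
  refine ⟨fun h N hN => h N (by omega), fun h N _ r r' hr hr' hv => ?_⟩
  rcases le_or_gt 3 N with h3 | h3
  · exact h N h3 r r' hr hr' hv
  · exact slice_of_slice_of_le (show N ≤ 3 by omega) (h 3 le_rfl) r r' hr hr' hv

/-- **`N ≠ 2` IS DECORATIVE, II**: the frame off the plane is the whole frame (`VolumeForm`,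
stmt-3814) — the plane descends from dimension `3` by one slab. [folklore] -/
theorem offPlane_iff_frame :
    (∀ N, N ≠ 2 → ∀ (r r' : KZ.IntegralRep N), (∀ x ∈ r.domain, r.integrand x = 1) →
      (∀ x ∈ r'.domain, r'.integrand x = 1) → r.value = r'.value → KZ.Equivalent r r') ↔
    (∀ N (r r' : KZ.IntegralRep N), (∀ x ∈ r.domain, r.integrand x = 1) →
      (∀ x ∈ r'.domain, r'.integrand x = 1) → r.value = r'.value → KZ.Equivalent r r') := by
  refine ⟨fun h N r r' hr hr' hv => ?_, fun h N _ => h N⟩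
  rcases eq_or_ne N 2 with rfl | hN
  · exact slice_of_slice_succ (h 3 (by decide)) r r' hr hr' hv
  · exact h N hN r r' hr hr' hv

/-- **THE FRAME IS CONJECTURE 1**: all slices together ↔ `KZPeriodConjecture'` (all pairs, any
dimensions, any integrands). `→`: the frame specialises to Cresson–Viu-Sos' compact volume
conjecture, equivalent to Conjecture 1 by the tree's discharge of Viu-Sos' semi-canonical reduction
`KZ.kzPeriodConjecture'_iff_volumeConjectureCompact_holds`; `←`: restriction.
[Cresson–Viu-Sos 2022, §1 p. 326; Viu-Sos 2021, Thm 1.1] [folklore] -/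
theorem frame_iff_kzPeriodConjecture' :
    (∀ N (r r' : KZ.IntegralRep N), (∀ x ∈ r.domain, r.integrand x = 1) →
      (∀ x ∈ r'.domain, r'.integrand x = 1) → r.value = r'.value → KZ.Equivalent r r') ↔
    KZPeriodConjecture' := by
  constructor
  · intro hV
    have hvc : KZ.volumeConjectureCompact := fun N r r' _ _ _ _ h1 h1' hv => hV N r r' h1 h1' hv
    exact KZ.kzPeriodConjecture'_iff_volumeConjectureCompact_holds.mpr hvc
  · intro h N r r' _ _ hv
    exact h r r' hv

/-- **THE CRUX IS THE SUMMIT**: the frame off the plane ↔ `KontsevichZagierPeriods` (the summit is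
Conjecture 1 restricted to KZ's literal shape, `kzPeriodConjecture'_iff_isRational`). [folklore] -/
theorem offPlane_iff_summit :
    (∀ N, N ≠ 2 → ∀ (r r' : KZ.IntegralRep N), (∀ x ∈ r.domain, r.integrand x = 1) →
      (∀ x ∈ r'.domain, r'.integrand x = 1) → r.value = r'.value → KZ.Equivalent r r') ↔
    KontsevichZagierPeriods := by
  rw [offPlane_iff_frame, frame_iff_kzPeriodConjecture', KontsevichZagierPeriods_iff]
  exact kzPeriodConjecture'_iff_isRational

/-- **A COUNTEREXAMPLE IN ANY DIMENSION KILLS THE OFF-PLANE FRAME** — the plane `N = 2` and the line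
included. [folklore] -/
theorem not_offPlane_of_counterexample {N : ℕ} (r r' : KZ.IntegralRep N)
    (hr : ∀ x ∈ r.domain, r.integrand x = 1) (hr' : ∀ x ∈ r'.domain, r'.integrand x = 1)
    (hv : r.value = r'.value) (hne : ¬ KZ.Equivalent r r') :
    ¬ ∀ N, N ≠ 2 → ∀ (r r' : KZ.IntegralRep N), (∀ x ∈ r.domain, r.integrand x = 1) →
      (∀ x ∈ r'.domain, r'.integrand x = 1) → r.value = r'.value → KZ.Equivalent r r' :=
  fun h => hne (offPlane_iff_frame.mp h N r r' hr hr' hv)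

/-- UP-SET: a counterexample in dimension `M` yields one in every dimension `N ≥ M` (slabs). [folklore] -/
theorem exists_counterexample_of_le {M N : ℕ} (hMN : M ≤ N) (r r' : KZ.IntegralRep M)
    (hr : ∀ x ∈ r.domain, r.integrand x = 1) (hr' : ∀ x ∈ r'.domain, r'.integrand x = 1)
    (hv : r.value = r'.value) (hne : ¬ KZ.Equivalent r r') :
    ∃ s s' : KZ.IntegralRep N, (∀ x ∈ s.domain, s.integrand x = 1) ∧
      (∀ x ∈ s'.domain, s'.integrand x = 1) ∧ s.value = s'.value ∧ ¬ KZ.Equivalent s s' := by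
  obtain ⟨d, rfl⟩ := Nat.exists_eq_add_of_le hMN
  obtain ⟨R, hR1, hR⟩ := exists_equivalent_add_integrand_one r hr d
  obtain ⟨R', hR'1, hR'⟩ := exists_equivalent_add_integrand_one r' hr' d
  refine ⟨R, R', hR1, hR'1, ?_, fun hE => hne ((hR.trans hE).trans hR'.symm)⟩
  rw [← KZ.Equivalent.value_eq_holds hR, ← KZ.Equivalent.value_eq_holds hR', hv]

/-- WHERE A COUNTEREXAMPLE LIVES: if the off-plane frame fails, it fails in some dimension `N ≥ 3`
with an explicit pair. [folklore] -/
theorem exists_ge_three_of_not_offPlane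
    (h : ¬ ∀ N, N ≠ 2 → ∀ (r r' : KZ.IntegralRep N), (∀ x ∈ r.domain, r.integrand x = 1) →
      (∀ x ∈ r'.domain, r'.integrand x = 1) → r.value = r'.value → KZ.Equivalent r r') :
    ∃ N, 3 ≤ N ∧ ∃ r r' : KZ.IntegralRep N, (∀ x ∈ r.domain, r.integrand x = 1) ∧
      (∀ x ∈ r'.domain, r'.integrand x = 1) ∧ r.value = r'.value ∧ ¬ KZ.Equivalent r r' := by
  rw [offPlane_iff_forall_ge_three] at h
  push Not at h
  exact h

/-! ## §2 Load-bearing analysis -/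

/-- **ANY PROOF MUST USE `value_eq`** (dimension `0`): with the value hypothesis dropped the slice
`N = 0` is false — the point `ℝ⁰` (integrand `1`, positive value: `KZ.IntegralRep.exists_volumeRep_zero`,
`value_pos_of_integrand_eq_one`) vs the empty set (value `0`), by soundness. [folklore] -/
theorem not_slice_zero_without_valueEq :
    ¬ (∀ (r r' : KZ.IntegralRep 0), (∀ x ∈ r.domain, r.integrand x = 1) →
        (∀ x ∈ r'.domain, r'.integrand x = 1) → KZ.Equivalent r r') := by
  intro h
  obtain ⟨C, hCc, hCi, hC1⟩ := KZ.IntegralRep.exists_volumeRep_zero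
  have hpos := C.value_pos_of_integrand_eq_one hCc hCi hC1
  have hv := KZ.Equivalent.value_eq_holds (h C (KZ.IntegralRep.empty 0) hC1 (by simp))
  rw [KZ.IntegralRep.value_empty] at hv
  exact hpos.ne' hv

/-- The same in the crux's open range, dimension `3`: a compact solid of positive volume (the point
raised by three unit slabs) vs the empty solid. So `value_eq` is load-bearing in every slice. [folklore] -/
theorem not_slice_three_without_valueEq :
    ¬ (∀ (r r' : KZ.IntegralRep 3), (∀ x ∈ r.domain, r.integrand x = 1) →
        (∀ x ∈ r'.domain, r'.integrand x = 1) → KZ.Equivalent r r') := by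
  intro h
  obtain ⟨C, hCc, hCi, hC1⟩ := KZ.IntegralRep.exists_volumeRep_zero
  obtain ⟨K, hKc, hKi, hK1, -⟩ := C.exists_volumeRep_equivalent_add hCc hCi hC1 3
  have hpos : 0 < K.value := K.value_pos_of_integrand_eq_one hKc hKi hK1
  have hv := KZ.Equivalent.value_eq_holds (h K (KZ.IntegralRep.empty 3) hK1 (by simp))
  rw [KZ.IntegralRep.value_empty] at hv
  exact hpos.ne' hv

/-- **`integrand = 1` IS A NORMALISATION, NOT A HYPOTHESIS**: the off-plane frame with BOTH
integrand hypotheses dropped is Conjecture 1 again (`→`: it still contains the integrand-`1`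
slices; `offPlane_iff_frame`, `frame_iff_kzPeriodConjecture'`; `←`: restriction). So no
`_false_without_integrandOne` lemma exists short of a disproof of Conjecture 1. [folklore] -/
theorem withoutIntegrandOne_iff_kzPeriodConjecture' :
    (∀ N, N ≠ 2 → ∀ (r r' : KZ.IntegralRep N), r.value = r'.value → KZ.Equivalent r r') ↔
      KZPeriodConjecture' := by
  constructor
  · intro h
    exact frame_iff_kzPeriodConjecture'.mp (offPlane_iff_frame.mp fun N hN r r' _ _ hv => h N hN r r' hv)
  · intro h N _ r r' hv
    exact h r r' hv

/-! ## §3 Degenerate instances hold: junk immunity of the encoding -/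

/-- VALUE ZERO MEANS NULL, NULL MEANS ZERO: an integrand-`1` representation of value `0` has a
null domain (its value is the finite volume of the domain), hence `[r]` is a relation (rule 1a for
`σ = σ ∪ σ` with null overlap; tree: `KZ.of_mem_levelRel_of_volume_eq_zero`). [folklore] -/
theorem of_mem_relations_of_value_eq_zero {N : ℕ} (r : KZ.IntegralRep N)
    (hr : ∀ x ∈ r.domain, r.integrand x = 1) (hv : r.value = 0) : KZ.of r ∈ KZ.relations := by
  have hint : IntegrableOn (fun _ => (1 : ℝ)) r.domain :=
    r.integrableOn.congr_fun (fun x hx => hr x hx) (KZ.IntegralRep.measurableSet_domain_holds r)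
  have hlt : volume r.domain < ⊤ := by simpa using (integrableOn_const_iff).mp hint
  have hval : r.value = volume.real r.domain := by
    rw [KZ.IntegralRep.value, setIntegral_congr_fun (KZ.IntegralRep.measurableSet_domain_holds r)
      (fun x hx => hr x hx), setIntegral_const, smul_eq_mul, mul_one]
  rw [hval, measureReal_def, ENNReal.toReal_eq_zero_iff] at hv
  exact KZ.levelRel_le_relations (KZ.of_mem_levelRel_of_volume_eq_zero r (hv.resolve_right hlt.ne))

/-- The value-`0` instances of every slice hold (both sides are relations). [folklore] -/
theorem equivalent_of_value_eq_zero {N : ℕ} (r r' : KZ.IntegralRep N)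
    (hr : ∀ x ∈ r.domain, r.integrand x = 1) (hr' : ∀ x ∈ r'.domain, r'.integrand x = 1)
    (hv : r.value = 0) (hv' : r'.value = 0) : KZ.Equivalent r r' :=
  KZ.relations.sub_mem (of_mem_relations_of_value_eq_zero r hr hv)
    (of_mem_relations_of_value_eq_zero r' hr' hv')

/-- OFF-DOMAIN VALUES ARE INVISIBLE: two integrand-`1` representations with the same domain are
equivalent (tree: `KZ.of_sub_of_mem_relations_of_eqOn`, integrand additivity with a zero rep). [folklore] -/
theorem equivalent_of_domain_eq {N : ℕ} (r r' : KZ.IntegralRep N)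
    (hr : ∀ x ∈ r.domain, r.integrand x = 1) (hr' : ∀ x ∈ r'.domain, r'.integrand x = 1)
    (h : r.domain = r'.domain) : KZ.Equivalent r r' :=
  KZ.of_sub_of_mem_relations_of_eqOn h.symm fun x hx => by rw [hr x hx, hr' x (h ▸ hx)]

/-- Lebesgue measure on `ℝ⁰ = {pt}` is the Dirac mass. [folklore] -/
theorem volume_fin_zero : (volume : Measure (Fin 0 → ℝ)) = Measure.dirac default := by
  rw [MeasureTheory.volume_pi]
  exact Measure.pi_of_empty _ _

/-- **THE SLICE `N = 0` IS A THEOREM** (the lead's `stub_dimZero`): a domain in `ℝ⁰ = {pt}` is `∅`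
or `{pt}`; equal values exclude the mixed case (`0 ≠ 1`), two points are one relation apart, two
empty sets are both relations. [folklore] -/
theorem slice_zero : ∀ (r r' : KZ.IntegralRep 0), (∀ x ∈ r.domain, r.integrand x = 1) →
    (∀ x ∈ r'.domain, r'.integrand x = 1) → r.value = r'.value → KZ.Equivalent r r' := by
  intro r r' hr hr' hv
  have hcase : ∀ s : Set (Fin 0 → ℝ), s = ∅ ∨ s = univ := fun s =>
    s.eq_empty_or_nonempty.imp id fun h => Subsingleton.eq_univ_of_nonempty h
  have hval0 : ∀ s : KZ.IntegralRep 0, s.domain = ∅ → s.value = 0 := fun s h => by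
    simp [KZ.IntegralRep.value, h]
  have hval1 : ∀ s : KZ.IntegralRep 0, (∀ x ∈ s.domain, s.integrand x = 1) → s.domain = univ →
      s.value = 1 := fun s hs h => by
    have hi : s.integrand = fun _ => 1 := funext fun x => hs x (h ▸ mem_univ x)
    simp [KZ.IntegralRep.value, h, hi, volume_fin_zero]
  rcases hcase r.domain with h1 | h1 <;> rcases hcase r'.domain with h2 | h2
  · exact equivalent_of_value_eq_zero r r' hr hr' (hval0 r h1) (hval0 r' h2)
  · exact absurd ((hval0 r h1).symm.trans (hv.trans (hval1 r' hr' h2))) zero_ne_one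
  · exact absurd ((hval0 r' h2).symm.trans (hv.symm.trans (hval1 r hr h1))) zero_ne_one
  · exact equivalent_of_domain_eq r r' hr hr' (h1.trans h2.symm)

/-! ## §4 The Dehn form: the only shape a refutation can take -/

/-- **DEHN FORM.** The off-plane frame fails iff there is an additive invariant of formal
ℤ-combinations of representations, vanishing on every instance of the four rules, that separates
two equal-volume integrand-`1` representations of some dimension `N ≥ 3` (a "generalised Dehn
invariant of ℚ-semialgebraic solids, finer than volume"). `→`: the quotient map by `KZ.relations`
and `exists_ge_three_of_not_offPlane`; `←`: kernels are subgroups. [folklore] -/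
theorem not_offPlane_iff_exists_invariant :
    (¬ ∀ N, N ≠ 2 → ∀ (r r' : KZ.IntegralRep N), (∀ x ∈ r.domain, r.integrand x = 1) →
      (∀ x ∈ r'.domain, r'.integrand x = 1) → r.value = r'.value → KZ.Equivalent r r') ↔
    ∃ (A : Type) (_ : AddCommGroup A) (D : KZ.FormalRep →+ A),
      (∀ c ∈ KZ.domainAddRel ∪ KZ.integrandAddRel ∪ KZ.changeOfVariablesRel ∪ KZ.newtonLeibnizRel,
        D c = 0) ∧
      ∃ N, 3 ≤ N ∧ ∃ r r' : KZ.IntegralRep N, (∀ x ∈ r.domain, r.integrand x = 1) ∧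
        (∀ x ∈ r'.domain, r'.integrand x = 1) ∧ r.value = r'.value ∧ D (KZ.of r) ≠ D (KZ.of r') := by
  constructor
  · intro hO
    obtain ⟨N, hN, r, r', hr, hr', hv, hne⟩ := exists_ge_three_of_not_offPlane hO
    refine ⟨KZ.FormalRep ⧸ KZ.relations, inferInstance, QuotientAddGroup.mk' KZ.relations,
      fun c hc => ?_, N, hN, r, r', hr, hr', hv, fun hD => hne ?_⟩
    · rw [QuotientAddGroup.mk'_apply, QuotientAddGroup.eq_zero_iff]
      exact AddSubgroup.subset_closure hc
    · rw [← sub_eq_zero, ← map_sub, QuotientAddGroup.mk'_apply, QuotientAddGroup.eq_zero_iff] at hD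
      exact hD
  · rintro ⟨A, _, D, hD, N, hN, r, r', hr, hr', hv, hne⟩ hO
    have hmem : KZ.of r - KZ.of r' ∈ KZ.relations := hO N (by omega) r r' hr hr' hv
    have hle : KZ.relations ≤ D.ker := (AddSubgroup.closure_le _).mpr fun c hc => hD c hc
    have h0 := hle hmem
    rw [AddMonoidHom.mem_ker, map_sub, sub_eq_zero] at h0
    exact hne h0

end Summit.KontsevichZagierPeriods.SymplecticScissors.VolumeFormOffPlaneNegative
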